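import Literature.AlgebraicGeometry.HodgeTheory.HodgeModelFormOfClass
import Literature.AlgebraicGeometry.HodgeTheory.AlgebraicChartHodgeModel
import Literature.AlgebraicGeometry.HodgeTheory.HodgeTypePullbackVanishing
import Literature.NumberTheory.Transcendental.DeRhamTheoremProofs
import Literature.NumberTheory.Transcendental.FormIntegrationPullbackCharts
import Literature.Analysis.Complex.OsgoodProofs
import HarnessLib

/-!
# Classes of holomorphic forms are natural under pull-back along morphisms of smooth projective varieties

Topic `AlgebraicGeometry/HodgeTheory`.  THEOREMS ONLY: no definition, no named fact, no instance, no notation, no `sorry`.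

For a `ℂ`-morphism `f : Y ⟶ X` of smooth projective varieties and a `p`-form `α` on `X^an` holomorphic in charts, the pulled-back
form `(f^an)^* α` is holomorphic in charts on `Y^an` (§1, Huybrechts Prop. 2.6.11: holomorphic maps pull holomorphic forms back to
holomorphic forms — here for manifolds on TWO model spaces `E`, `E'`, the one-model case being the pattern of the tree's
`CyclicUnitaryPowersHolFormPullback`), and ITS CLASS IS THE PULLED-BACK CLASS:

  `[(f^an)^* α] = (f^an)^* [α]`  in `Hᵖ(Y^an; ℂ)`,  i.e.  `= f(ℂ)^* [α]` read on `Hᵖ(Y(ℂ); ℂ)` (§2–§3),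

for the ALGEBRAIC-CHART Hodge models `algebraicModel hX`, `algebraicModel hY` (★ `AlgebraicChartHodgeModel`: carrier `X(ℂ)`, model
`ℂⁿ`, comparison `id`, de Rham family = the complexified INTEGRATION isomorphisms).  The point of the restriction: `HodgeModel.holFormClass`
is read through the model's de Rham family `A.deRham`, an arbitrary natural family on manifolds charted on `A.model` — natural only for maps
between manifolds on the SAME model type (`ComplexDeRhamIsoFamily.IsNatural`), so that across two models of two varieties nothing relates the
two families (a natural family may be rescaled by any non-zero scalar).  The algebraic-chart models all carry ONE family, the integration
family, which IS natural across model spaces (★ `integrationDeRhamIsoFamily_complexify_natural₂`, Lee Thm. 18.14 ∕ de Rham's theorem), and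
their comparison maps are identities, so `f^an = f(ℂ)` on the nose (`anMap_algebraicModel_apply`).  §3 reads the identity through the
models' `pullback` (`HodgeModel.map_anMap_pullback`) and derives the uniqueness consequence for degree `1`: the holomorphic `1`-form of a
pulled-back `(1,0)`-class is the pulled-back `1`-form (`oneFormOfClass`, ★ `eq_oneFormOfClass_of_holFormClass_eq`).

Consumer (cell `hodgecm-mathlib`, P5 line `F0_AlbCm`, sub-line S1-R, glue M5): Hecke equivariance of the realisation of `H¹` of the unitary
Shimura curve tower in cotangent automorphic forms — the piece morphism `f : X_q ⟶ X'_{q'}` under a Hecke translate (★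
`UnitaryShimuraCurveHeckeConeTransport.exists_pieceHom_comp_eq`) pulls the holomorphic `1`-form of a class back to the holomorphic `1`-form of
the pulled-back class.

## References
* [HuybrechtsCG2005, Prop. 2.6.11] D. Huybrechts, *Complex Geometry* (2005), Prop. 2.6.11 ff. (pull-back of holomorphic forms).
* [VoisinHodgeI2002, §7.1.1 Cor. 7.6 and §7.3.2] C. Voisin, *Hodge Theory and Complex Algebraic Geometry I* (2002).
* [LeeSmoothManifolds2013, Thm. 18.14] J. M. Lee, *Introduction to Smooth Manifolds*, 2nd ed. (2013) (naturality of de Rham).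
* [SerreGAGA1956, §2 n°5] J.-P. Serre, GAGA (1956) (functoriality of `X^h`).
* [HormanderSCV1973, Thm. 2.2.1] L. Hörmander, *An introduction to complex analysis in several variables* (Osgood's lemma).
-/

noncomputable section

open scoped Manifold ContDiff Topology
open Set Filter CategoryTheory
open Literature.Geometry.Kaehler Literature.NumberTheory.Transcendental Literature.AlgebraicTopology.SingularHomology

namespace Literature.AlgebraicGeometry.HodgeTheory

/-! ### §1 Pull-back of holomorphic-in-charts forms along holomorphic maps (two model spaces) -/

section TwoModels

variable {E : Type*} [NormedAddCommGroup E] [NormedSpace ℂ E] [FiniteDimensional ℂ E]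
  {E' : Type*} [NormedAddCommGroup E'] [NormedSpace ℂ E'] [FiniteDimensional ℂ E']
  {M : Type*} [TopologicalSpace M] [ChartedSpace E M] [IsManifold 𝓘(ℂ, E) ω M] [IsManifold 𝓘(ℝ, E) ∞ M]
  {N : Type*} [TopologicalSpace N] [ChartedSpace E' N] [IsManifold 𝓘(ℂ, E') ω N] [IsManifold 𝓘(ℝ, E') ∞ N]
  {k : ℕ}

/-- **The pull-back of a holomorphic-in-charts form along a holomorphic map is holomorphic in charts** — manifolds `M`, `N` on two complex
model spaces `E`, `E'`, `β` a `k`-form on `N` holomorphic in charts, `f : M → N` holomorphic (with its real-differentiable reading `hfR`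
supplied): in the charts at `x₀` and `f x₀` the representative of `f^*β` is `y ↦ g(σ y) ∘ Λᵏ dσ(y)` (★ `MForm.inChart_pullback_apply`) with `σ`
the transition map `E → E'` through `f` (complex-differentiable on an open set, hence analytic: Osgood, ★ `SCV.analyticAt_of_differentiableOn`)
and `g` the analytic germ of `β`, so it is analytic (`ContDiffAt.continuousAlternatingMapCompContinuousLinearMap` at `n = ω`).  The one-model
case is the tree's `CyclicUnitaryPowersHolFormPullback.isHolomorphicInCharts_pullback` (Summits-side), whose proof this follows line by line.
[cite: HuybrechtsCG2005, Prop. 2.6.11] [cite: HormanderSCV1973, Thm. 2.2.1] -/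
theorem isHolomorphicInCharts_pullback₂ {β : MForm 𝓘(ℝ, E') N ℂ k} (hβ : IsHolomorphicInCharts β) {f : M → N}
    (hf : MDifferentiable 𝓘(ℂ, E) 𝓘(ℂ, E') f) (hfR : MDifferentiable 𝓘(ℝ, E) 𝓘(ℝ, E') f) :
    IsHolomorphicInCharts (β.pullback 𝓘(ℝ, E) f) := by
  intro x₀
  set x₁ := f x₀ with hx₁
  obtain ⟨g, hg, hβg⟩ := hβ x₁
  set c₀ : E := extChartAt 𝓘(ℝ, E) x₀ x₀ with hc₀
  set c₁ : E' := extChartAt 𝓘(ℝ, E') x₁ x₁ with hc₁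
  set σ : E → E' := extChartAt 𝓘(ℝ, E') x₁ ∘ f ∘ (extChartAt 𝓘(ℝ, E) x₀).symm with hσ
  -- the good open set around `c₀`
  set U : Set E := (extChartAt 𝓘(ℝ, E) x₀).target ∩
    (extChartAt 𝓘(ℝ, E) x₀).symm ⁻¹' (f ⁻¹' (extChartAt 𝓘(ℝ, E') x₁).source) with hU
  have hUo : IsOpen U :=
    (continuousOn_extChartAt_symm x₀).isOpen_inter_preimage (isOpen_extChartAt_target x₀)
      ((isOpen_extChartAt_source x₁).preimage hf.continuous)
  have hc₀U : c₀ ∈ U := by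
    refine ⟨mem_extChartAt_target x₀, ?_⟩
    show f ((extChartAt 𝓘(ℝ, E) x₀).symm c₀) ∈ (extChartAt 𝓘(ℝ, E') x₁).source
    rw [hc₀, extChartAt_to_inv]
    exact mem_extChartAt_source x₁
  -- `σ` is complex-differentiable on `U`, hence analytic at `c₀`
  have hσU : DifferentiableOn ℂ σ U := by
    intro y hy
    have h1 : MDifferentiableAt 𝓘(ℂ, E) 𝓘(ℂ, E') f ((extChartAt 𝓘(ℂ, E) x₀).symm y) := hf _
    have h2 : MDifferentiableWithinAt 𝓘(ℂ, E) 𝓘(ℂ, E) (extChartAt 𝓘(ℂ, E) x₀).symm (range 𝓘(ℂ, E)) y :=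
      mdifferentiableWithinAt_extChartAt_symm hy.1
    have h3 : MDifferentiableAt 𝓘(ℂ, E') 𝓘(ℂ, E') (extChartAt 𝓘(ℂ, E') x₁) (f ((extChartAt 𝓘(ℂ, E) x₀).symm y)) :=
      mdifferentiableAt_extChartAt (by rw [← extChartAt_source 𝓘(ℂ, E')]; exact hy.2)
    have h4 := (h3.comp _ h1).comp_mdifferentiableWithinAt y h2
    rw [ModelWithCorners.Boundaryless.range_eq_univ, mdifferentiableWithinAt_univ,
      mdifferentiableAt_iff_differentiableAt] at h4
    exact h4.differentiableWithinAt
  have hσan : AnalyticAt ℂ σ c₀ :=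
    Literature.Analysis.Complex.SCV.analyticAt_of_differentiableOn hσU hUo hc₀U
  have hσc₀ : σ c₀ = c₁ := by
    simp only [hσ, hc₀, hc₁, Function.comp_apply, extChartAt_to_inv]
    rw [← hx₁]
  -- the analytic germ of the pull-back
  set G : E → E [⋀^Fin k]→L[ℂ] ℂ := fun y ↦ (g (σ y)).compContinuousLinearMap (fderiv ℂ σ y) with hG
  have hGan : AnalyticAt ℂ G c₀ := by
    have hgσ : AnalyticAt ℂ g (σ c₀) := by rw [hσc₀]; exact hg
    have h1 : ContDiffAt ℂ ω (fun y ↦ g (σ y)) c₀ := (hgσ.comp hσan).contDiffAt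
    have h2 : ContDiffAt ℂ ω (fun y ↦ fderiv ℂ σ y) c₀ := hσan.fderiv.contDiffAt
    exact (ContDiffAt.continuousAlternatingMapCompContinuousLinearMap h1 h2).analyticAt
  refine ⟨G, hGan, ?_⟩
  -- the chart formula, near `c₀`
  have hev1 : ∀ᶠ y in 𝓝 c₀, y ∈ U := hUo.mem_nhds hc₀U
  have hev2 : ∀ᶠ y in 𝓝 c₀, β.inChart x₁ (σ y) = (g (σ y)).restrictScalars ℝ := by
    have ht : Tendsto σ (𝓝 c₀) (𝓝 c₁) := by rw [← hσc₀]; exact hσan.continuousAt.tendsto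
    exact ht.eventually hβg
  filter_upwards [hev1, hev2] with y hyU hyg
  have hyd : DifferentiableAt ℂ σ y := hσU.differentiableAt (hUo.mem_nhds hyU)
  have hfd : fderivWithin ℝ σ (range 𝓘(ℝ, E)) y = (fderiv ℂ σ y).restrictScalars ℝ := by
    rw [ModelWithCorners.Boundaryless.range_eq_univ, fderivWithin_univ]
    exact (hyd.hasFDerivAt.restrictScalars ℝ).fderiv
  ext v
  rw [MForm.inChart_pullback_apply β hyU.1 (hfR _) hyU.2 v]
  change β.inChart x₁ (σ y) (fun i ↦ fderivWithin ℝ σ (range 𝓘(ℝ, E)) y (v i)) = _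
  rw [hyg, hfd]
  rfl

/-- Submodule form: `(f^an)^* α ∈ holFormsInCharts` for `α ∈ holFormsInCharts` and `f` holomorphic. [cite: HuybrechtsCG2005, Prop. 2.6.11] -/
theorem pullback_mem_holFormsInCharts₂ {α : MForm 𝓘(ℝ, E') N ℂ k} (hα : α ∈ holFormsInCharts E' N k) {f : M → N}
    (hf : MDifferentiable 𝓘(ℂ, E) 𝓘(ℂ, E') f) (hfR : MDifferentiable 𝓘(ℝ, E) 𝓘(ℝ, E') f) :
    α.pullback 𝓘(ℝ, E) f ∈ holFormsInCharts E M k :=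
  isHolomorphicInCharts_pullback₂ hα hf hfR

end TwoModels

/-! ### §2 The class of the pulled-back holomorphic form, for the algebraic-chart Hodge models -/

section Classes

variable {n m : ℕ} {X Y : Motives.SchemeOver ℂ} (hX : Motives.IsSmoothProjective n X) (hY : Motives.IsSmoothProjective m Y)
  (f : Y ⟶ X)

/-- `f^an = f(ℂ)` for the algebraic-chart models (their comparison maps are identities). [cite: SerreGAGA1956, §2 n°5] -/
theorem anMap_algebraicModel_apply (y : (algebraicModel hY).carrier) :
    HodgeModel.anMap (algebraicModel hX) (algebraicModel hY) f y = Motives.AlgPoints.map f y := by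
  have h := HodgeModel.toComplexPoints_anMap (algebraicModel hX) (algebraicModel hY) f y
  rwa [algebraicModel_toComplexPoints_apply, algebraicModel_toComplexPoints_apply] at h

/-- `f^an` is holomorphic and real-`C^∞` between the algebraic-chart models (GAGA ★ `HodgeModel.mdifferentiable_anMap`). [cite: SerreGAGA1956, §2 n°5] -/
theorem mdifferentiable_anMap_algebraicModel :
    MDifferentiable 𝓘(ℂ, (algebraicModel hY).model) 𝓘(ℂ, (algebraicModel hX).model)
        (HodgeModel.anMap (algebraicModel hX) (algebraicModel hY) f) ∧
      MDifferentiable 𝓘(ℝ, (algebraicModel hY).model) 𝓘(ℝ, (algebraicModel hX).model)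
        (HodgeModel.anMap (algebraicModel hX) (algebraicModel hY) f) :=
  ⟨HodgeModel.mdifferentiable_anMap _ _ f hY hX, fun y => (HodgeModel.mdifferentiable_anMap _ _ f hY hX y).real_of_complex⟩

/-- **The pulled-back holomorphic form** `(f^an)^* α` as a member of `holFormsInCharts` of `Y^an` (algebraic-chart models).
[cite: HuybrechtsCG2005, Prop. 2.6.11] -/
theorem pullback_anMap_mem_holFormsInCharts {p : ℕ} (α : holFormsInCharts (algebraicModel hX).model (algebraicModel hX).carrier p) :
    (α : MForm 𝓘(ℝ, (algebraicModel hX).model) (algebraicModel hX).carrier ℂ p).pullback 𝓘(ℝ, (algebraicModel hY).model)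
        (HodgeModel.anMap (algebraicModel hX) (algebraicModel hY) f) ∈
      holFormsInCharts (algebraicModel hY).model (algebraicModel hY).carrier p :=
  pullback_mem_holFormsInCharts₂ α.2 (mdifferentiable_anMap_algebraicModel hX hY f).1 (mdifferentiable_anMap_algebraicModel hX hY f).2

/-- **`[(f^an)^* α] = (f^an)^* [α]` in `Hᵖ(Y^an; ℂ)`** for the algebraic-chart Hodge models of smooth projective `X`, `Y` and any `f : Y ⟶ X`:
the class of the pulled-back holomorphic `p`-form is the pull-back of the class (`holFormClass` = de Rham class read through the
INTEGRATION family, natural across model spaces ★ `integrationDeRhamIsoFamily_complexify_natural₂`; ★ `complexDeRhamCohomology.map_mk`).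
[cite: LeeSmoothManifolds2013, Thm. 18.14] [cite: VoisinHodgeI2002, §7.3.2] -/
theorem holFormClass_pullback_anMap {p : ℕ} (hclX : (algebraicModel hX).HolFormsClosed p) (hclY : (algebraicModel hY).HolFormsClosed p)
    (α : holFormsInCharts (algebraicModel hX).model (algebraicModel hX).carrier p) :
    (algebraicModel hY).holFormClass p hclY ⟨_, pullback_anMap_mem_holFormsInCharts hX hY f α⟩ =
      singularCohomology.map ℂ ℂ ⟨HodgeModel.anMap (algebraicModel hX) (algebraicModel hY) f,
          HodgeModel.continuous_anMap (algebraicModel hX) (algebraicModel hY) f⟩ p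
        ((algebraicModel hX).holFormClass p hclX α) := by
  have hsm := HodgeModel.contMDiff_anMap (algebraicModel hX) (algebraicModel hY) f hY hX
  -- the de Rham families of the algebraic-chart models ARE the integration families (model types kept folded)
  have hA : (algebraicModel hX).deRham = (integrationDeRhamIsoFamily (algebraicModel hX).model).complexify := rfl
  have hB : (algebraicModel hY).deRham = (integrationDeRhamIsoFamily (algebraicModel hY).model).complexify := rfl
  rw [HodgeModel.holFormClass_apply, HodgeModel.holFormClass_apply, hA, hB,
    ← integrationDeRhamIsoFamily_complexify_natural₂ hsm p, complexDeRhamCohomology.map_mk]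
  rfl

/-! ### §3 Read through `X(ℂ)`: `[(f^an)^* α] = f(ℂ)^* [α]`, and the degree-`1` uniqueness consequence -/

/-- **`[(f^an)^* α]` is `f(ℂ)^* c` whenever `[α]` is `c`**, classes read on the complex points through the models' `pullback`
(`A^*`, ★ `HodgeModel.map_anMap_pullback`): if `A_X.holFormClass α = A_X^* c` then `A_Y.holFormClass ((f^an)^*α) = A_Y^* (f(ℂ)^* c)`.
[cite: VoisinHodgeI2002, §7.3.2] [cite: SerreGAGA1956, §2 n°5] -/
theorem holFormClass_pullback_anMap_eq_pullback_map {p : ℕ} (hclX : (algebraicModel hX).HolFormsClosed p)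
    (hclY : (algebraicModel hY).HolFormsClosed p)
    (α : holFormsInCharts (algebraicModel hX).model (algebraicModel hX).carrier p)
    {c : singularCohomology ℂ ℂ (Motives.ComplexPoints X) p}
    (hc : (algebraicModel hX).holFormClass p hclX α = (algebraicModel hX).pullback p c) :
    (algebraicModel hY).holFormClass p hclY ⟨_, pullback_anMap_mem_holFormsInCharts hX hY f α⟩ =
      (algebraicModel hY).pullback p (singularCohomology.map ℂ ℂ (Motives.AlgPoints.mapContinuous (L := ℂ) f) p c) := by
  rw [holFormClass_pullback_anMap hX hY f hclX hclY α, hc, HodgeModel.map_anMap_pullback]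

/-- **Degree `1`: the holomorphic `1`-form of a pulled-back class is the pulled-back `1`-form.**  If `α` represents `Θ_X η`
(`A_X.holFormClass α = A_X.complexification η`) and `η'` is a class of `Y` with `A_Y.complexification η' = (f^an)^* (A_X.complexification η)`
(the pulled-back class, in whatever currency the consumer carries it), then `(f^an)^* α = A_Y.oneFormOfClass η'` (uniqueness of the holomorphic
representative, ★ `eq_oneFormOfClass_of_holFormClass_eq`). [cite: VoisinHodgeI2002, §7.1.1 Cor. 7.6 and §7.3.2] -/
theorem pullback_anMap_eq_oneFormOfClass (hclX : (algebraicModel hX).HolFormsClosed 1) (hclY : (algebraicModel hY).HolFormsClosed 1)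
    (α : holFormsInCharts (algebraicModel hX).model (algebraicModel hX).carrier 1)
    {η : TensorProduct ℚ ℂ (singularCohomology ℚ ℚ (Motives.ComplexPoints X) 1)}
    (hα : (algebraicModel hX).holFormClass 1 hclX α = (algebraicModel hX).complexification hX 1 η)
    {η' : TensorProduct ℚ ℂ (singularCohomology ℚ ℚ (Motives.ComplexPoints Y) 1)}
    (hη' : (algebraicModel hY).complexification hY 1 η' =
      singularCohomology.map ℂ ℂ ⟨HodgeModel.anMap (algebraicModel hX) (algebraicModel hY) f,
          HodgeModel.continuous_anMap (algebraicModel hX) (algebraicModel hY) f⟩ 1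
        ((algebraicModel hX).complexification hX 1 η)) :
    (⟨_, pullback_anMap_mem_holFormsInCharts hX hY f α⟩ : holFormsInCharts (algebraicModel hY).model (algebraicModel hY).carrier 1) =
      (algebraicModel hY).oneFormOfClass hY hclY η' :=
  (algebraicModel hY).eq_oneFormOfClass_of_holFormClass_eq hY hclY
    (by rw [holFormClass_pullback_anMap hX hY f hclX hclY α, hα, hη'])

end Classes

end Literature.AlgebraicGeometry.HodgeTheory

end
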